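import Summits.RiemannHypothesis.RiemannHypothesis.Theorems.Splittings.LiWindowComplex
import HarnessLib

/-!
# The curvature `d_n = λ_{n+2} − 2λ_{n+1} + λ_n` of Li's coefficients under RH: an absolutely convergent almost-periodic sequence with both signs in every window (SketchG7 §2)

Cell rh-split, seat rh-split-li-bridge g7 (brief sha16 f79c5f09d8bcb036), card `run/shared/lean/pub/rh-split/cards/SPLIT-li-bridge.md` §14
(referee rh-split-ref g5: REPLAY PASS of v1 353a9a80816aea0e + v2 ca059ef508c1d3b5, 08:37:53Z; labels L1–L4 there); kernel source
`HOME/rh-split-li-bridge/SketchG7.lean` sha16 dac2b83ce457a730 (1546 l; = v2 + §5e `not_tendsto_liSecondDiff/_liFdiff` + 28 one-line docstrings,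
no decl text changed).  Cut by the seat (lead RULING #60, lane (xi-g)) into SIX tree modules at the scratch's section boundaries, decl text
byte-verbatim; deltas = namespace `RhSplit.LiBridgeG7` ↦ `…Theorems.Splittings.{LiWindowComplex, LiCurvatureSignChanges, LiDifferenceOrderLaw}`
(+ `open` of the earlier namespaces of the chain), module docstrings, and the variable-free wrapper `section HigherOrder … end HigherOrder`
dropped.  END-TO-END statement of the chain (last file): `LiDifferenceOrderLaw.liFdiff_signs_syndetic (hK : 2 ≤ K) :
∃ η > 0, ∃ L, ∀ N, (∃ n ∈ Ico N (N+L), fdiff K keiperLiCoeff n ≤ −η) ∧ (∃ n ∈ Ico N (N+L), η ≤ fdiff K keiperLiCoeff n)` — every forward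
difference of order `K ≥ 2` of Li's coefficients (K = 2: the curvature `d_n = λ_{n+2} − 2λ_{n+1} + λ_n`, file `LiCurvatureSignChanges`) takes
BOTH signs with a margin on a syndetic set, UNCONDITIONALLY (proof by cases on `RiemannHypothesis`; an RH-free kernel theorem about `λ_n`
alone, referee label L1; certifies nothing about RH; class (li, bridge) unchanged).

This file: §2 RH branch: the box model (`box`, `coef`, `unitZ`; `cmass_box`: coefficient mass `2 Re Λ₁(T) ≤ 2λ₁`, `csqMass` positive and monotone), the uniform tail
`abs_liSecondDiff_sub_ctrigSum_le` (from the tree's `LiSecondOrderCriterion.boxSum_secondDiff / re_boxSum_one_*`), resonance `u_ρ u_ρ' = 1 ⟺ ρ' = ρ̄` handled by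
`riemannZetaZeroOrder_conj_holds`, and `liSecondDiff_two_signs_of_rh : RH → ∃ η > 0, ∃ L, ∀ N ≥ 1, (∃ n ∈ Ico N (N+L), η ≤ d_n) ∧ (∃ n ∈ Ico N (N+L), d_n ≤ −η)`
(RH-IMPLIED kernel estimate, referee label L2).

HONEST LABEL: «SPLITTING SEARCH over kernel-typed RH-EQUIVALENCES; a splitting A ∧ B ⟹ RH is CONDITIONAL bookkeeping unless A and B are
both proved; nothing here bears on the truth of RH.»
-/

set_option linter.dupNamespace false

noncomputable section

namespace Summit.RiemannHypothesis.RiemannHypothesis.Theorems.Splittings.LiCurvatureSignChanges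

open Complex Filter Topology Finset
open scoped Real ComplexConjugate
open Literature.NumberTheory.LFunctions
open Summit.RiemannHypothesis.RiemannHypothesis.Theorems.Splittings
open Summit.RiemannHypothesis.RiemannHypothesis.Theorems.Splittings.LiIndexSets
open Summit.RiemannHypothesis.RiemannHypothesis.Theorems.Splittings.LiExtremalLayer
open Summit.RiemannHypothesis.RiemannHypothesis.Theorems.Splittings.LiSecondOrderCriterion
open Summit.RiemannHypothesis.RiemannHypothesis.Theorems.Splittings.LiWindowComplex

/-! ## §2 Under RH: `d_n` is an absolutely convergent almost-periodic sequence — both signs, with a margin, in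
every window (the box model + a uniformly small tail) -/

section RHBranch

/-- The Bombieri–Lagarias box `{ρ : ζ(ρ) = 0, 0 ≤ Re ρ ≤ 1, 0 < |Im ρ| ≤ T}` as a `Finset`. -/
def box (T : ℝ) : Finset ℂ := (liZeroBox_finite T).toFinset

/-- The curvature coefficient `c_ρ = −m(ρ)/ρ²`. -/
def coef (ρ : ℂ) : ℂ := -((riemannZetaZeroOrder ρ : ℂ) / ρ ^ 2)

/-- `u_ρ = 1 − 1/ρ`. -/
def unitZ (ρ : ℂ) : ℂ := 1 - 1 / ρ

/-- Membership in `box T` is membership in the tree's `liZeroBox T`. -/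
theorem mem_box {T : ℝ} {ρ : ℂ} : ρ ∈ box T ↔ ρ ∈ liZeroBox T := Set.Finite.mem_toFinset _

/-- `box` is monotone in the height `T`. -/
theorem box_mono {T T' : ℝ} (h : T ≤ T') : box T ⊆ box T' := by
  intro ρ hρ
  rw [mem_box] at hρ ⊢
  obtain ⟨a, b, c', d, e⟩ := hρ
  exact ⟨a, b, c', d, e.trans h⟩

/-- RH-free facts on a box zero: `ρ ≠ 0`, `m(ρ) > 0`, `u_ρ ≠ 1`, `ρ̄` lies in the box, `c_ρ̄ = c̄_ρ`
(`conj_mem_liZeroBox`, `riemannZetaZeroOrder_conj_holds`). -/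
theorem box_aux {T : ℝ} {ρ : ℂ} (hρ : ρ ∈ box T) :
    ρ ≠ 0 ∧ (0 : ℝ) < riemannZetaZeroOrder ρ ∧ unitZ ρ ≠ 1 ∧ conj ρ ∈ box T ∧
      coef (conj ρ) = conj (coef ρ) := by
  have hρ' : ρ ∈ liZeroBox T := mem_box.1 hρ
  obtain ⟨hρ0, hρ1, -, -⟩ := mem_liZeroBox_aux hρ'
  have hm : (0 : ℝ) < riemannZetaZeroOrder ρ := by
    exact_mod_cast (riemannZetaZeroOrder_pos_iff hρ1).2 hρ'.1
  refine ⟨hρ0, hm, ?_, mem_box.2 (conj_mem_liZeroBox hρ'), ?_⟩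
  · intro h
    rw [unitZ, sub_eq_self, one_div, inv_eq_zero] at h
    exact hρ0 h
  · rw [coef, coef, riemannZetaZeroOrder_conj_holds ρ, map_neg, map_div₀, map_pow, map_intCast]

/-- Under RH a box zero is on the line: `Re ρ = 1/2`, `‖u_ρ‖ = 1`, `1 − ρ = ρ̄`. -/
theorem box_rh (hRH : RiemannHypothesis) {T : ℝ} {ρ : ℂ} (hρ : ρ ∈ box T) :
    ρ.re = 1 / 2 ∧ ‖unitZ ρ‖ = 1 ∧ 1 - ρ = conj ρ := by
  have hre := re_eq_half_of_mem_liZeroBox hRH (mem_box.1 hρ)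
  refine ⟨hre, norm_one_sub_inv_eq_one hre, Complex.ext ?_ ?_⟩
  · simp only [Complex.sub_re, Complex.one_re, Complex.conj_re, hre]; norm_num
  · simp only [Complex.sub_im, Complex.one_im, Complex.conj_im, zero_sub]

/-- `‖c_ρ‖ = m(ρ)/|ρ|²`. -/
theorem norm_coef {ρ : ℂ} (hm : (0 : ℝ) ≤ riemannZetaZeroOrder ρ) :
    ‖coef ρ‖ = (riemannZetaZeroOrder ρ : ℝ) / ‖ρ‖ ^ 2 := by
  rw [coef, norm_neg, norm_div, norm_pow, Complex.norm_intCast, abs_of_nonneg hm]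

/-- Under RH, `‖c_ρ‖ = m/|ρ|² = 2 · m · Re ρ/|ρ|²` (the summand of `Re Λ₁(T)`, tree `re_boxSum_one_eq`). -/
theorem norm_coef_rh (hRH : RiemannHypothesis) {T : ℝ} {ρ : ℂ} (hρ : ρ ∈ box T) :
    ‖coef ρ‖ = 2 * ((riemannZetaZeroOrder ρ : ℝ) * (ρ.re / Complex.normSq ρ)) := by
  obtain ⟨hρ0, hm, -, -, -⟩ := box_aux hρ
  obtain ⟨hre, -, -⟩ := box_rh hRH hρ
  rw [norm_coef hm.le, Complex.sq_norm, hre]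
  have hpos : 0 < Complex.normSq ρ := Complex.normSq_pos.2 hρ0
  field_simp

/-- Under RH the total mass of the box model is `2 Re Λ₁(T)`. -/
theorem cmass_box (hRH : RiemannHypothesis) (T : ℝ) :
    cmass (box T) coef = 2 * ((∑ ρ ∈ (liZeroBox_finite T).toFinset,
      (riemannZetaZeroOrder ρ : ℂ) * (1 - (1 - 1 / ρ) ^ 1))).re := by
  rw [re_boxSum_one_eq, Finset.mul_sum, cmass, box]
  exact Finset.sum_congr rfl fun ρ hρ ↦ norm_coef_rh hRH hρ

/-- … hence `M_T ≤ 2λ₁` (tree `re_boxSum_one_le`). -/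
theorem cmass_box_le (hRH : RiemannHypothesis) (T : ℝ) : cmass (box T) coef ≤ 2 * keiperLiCoeff 1 := by
  rw [cmass_box hRH T]; linarith [re_boxSum_one_le T]

/-- The mean square `csqMass (box T) coef` is monotone in `T`. -/
theorem csqMass_mono {T T' : ℝ} (h : T ≤ T') : csqMass (box T) coef ≤ csqMass (box T') coef :=
  Finset.sum_le_sum_of_subset_of_nonneg (box_mono h) fun _ _ _ ↦ sq_nonneg _

/-- A non-empty box has `σ² > 0`. -/
theorem csqMass_box_pos {T : ℝ} (hT : (box T).Nonempty) : 0 < csqMass (box T) coef := by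
  refine Finset.sum_pos (fun ρ hρ ↦ ?_) hT
  obtain ⟨hρ0, hm, -, -, -⟩ := box_aux hρ
  have : coef ρ ≠ 0 := by
    rw [coef, neg_ne_zero, div_ne_zero_iff]
    exact ⟨by exact_mod_cast hm.ne', pow_ne_zero _ hρ0⟩
  exact pow_pos (norm_pos_iff.2 this) 2

/-- Under RH every frequency `u_ρ`, `ρ ∈ box T`, lies on the unit circle. -/
theorem box_hu (hRH : RiemannHypothesis) (T : ℝ) : ∀ ρ ∈ box T, ‖unitZ ρ‖ = 1 :=
  fun _ hρ ↦ (box_rh hRH hρ).2.1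

/-- `u_ρ ≠ 1` for every `ρ ∈ box T` (no zero frequency). -/
theorem box_hu1 (T : ℝ) : ∀ ρ ∈ box T, unitZ ρ ≠ 1 := fun _ hρ ↦ (box_aux hρ).2.2.1

/-- The RESONANCE `u_ρ u_ρ' = 1` means `ρ' = 1 − ρ`, under RH `= ρ̄`, and `c_ρ̄ = c̄_ρ`: sign-coherent. -/
theorem box_hres (hRH : RiemannHypothesis) (T : ℝ) :
    ∀ ρ ∈ box T, ∀ ρ' ∈ box T, unitZ ρ * unitZ ρ' = 1 → 0 ≤ (coef ρ * coef ρ').re := by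
  intro ρ hρ ρ' hρ' h
  obtain ⟨hρ0, -, -, -, hconj⟩ := box_aux hρ
  obtain ⟨hρ0', -, -, -, -⟩ := box_aux hρ'
  obtain ⟨-, -, h1ρ⟩ := box_rh hRH hρ
  have e1 : (1 : ℂ) - 1 / ρ = (ρ - 1) / ρ := by field_simp
  have e2 : (1 : ℂ) - 1 / ρ' = (ρ' - 1) / ρ' := by field_simp
  have key : (ρ - 1) * (ρ' - 1) = ρ * ρ' := by
    have h' : (ρ - 1) / ρ * ((ρ' - 1) / ρ') = 1 := by rw [← e1, ← e2]; exact h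
    rw [div_mul_div_comm, div_eq_one_iff_eq (mul_ne_zero hρ0 hρ0')] at h'
    exact h'
  have hρ'eq : ρ' = conj ρ := by rw [← h1ρ]; linear_combination -key
  rw [hρ'eq, hconj, Complex.mul_conj, Complex.ofReal_re]
  exact Complex.normSq_nonneg _

/-- `u_ρ = u_ρ'` only for `ρ = ρ'`. -/
theorem box_hres' (T : ℝ) :
    ∀ ρ ∈ box T, ∀ ρ' ∈ box T, unitZ ρ = unitZ ρ' → 0 ≤ (coef ρ * conj (coef ρ')).re := by
  intro ρ _ ρ' _ h
  have : ρ = ρ' := by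
    rw [unitZ, unitZ, sub_right_inj, one_div, one_div, inv_inj] at h
    exact h
  rw [← this, Complex.mul_conj, Complex.ofReal_re]
  exact Complex.normSq_nonneg _

/-- The box model `g_T(n) = Σ_{ρ ∈ box T} Re(c_ρ u_ρⁿ)` is the real part of the second difference of the box
sums (tree `boxSum_secondDiff`). -/
theorem ctrigSum_box_eq (n : ℕ) (T : ℝ) :
    ctrigSum (box T) coef unitZ n =
      ((∑ ρ ∈ (liZeroBox_finite T).toFinset, (riemannZetaZeroOrder ρ : ℂ) * (1 - (1 - 1 / ρ) ^ (n + 2)))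
        - 2 * (∑ ρ ∈ (liZeroBox_finite T).toFinset, (riemannZetaZeroOrder ρ : ℂ) * (1 - (1 - 1 / ρ) ^ (n + 1)))
        + (∑ ρ ∈ (liZeroBox_finite T).toFinset, (riemannZetaZeroOrder ρ : ℂ) * (1 - (1 - 1 / ρ) ^ n))).re := by
  rw [boxSum_secondDiff, Complex.neg_re, Complex.re_sum, ← Finset.sum_neg_distrib, ctrigSum, box]
  refine Finset.sum_congr rfl fun ρ _ ↦ ?_
  rw [← Complex.neg_re, coef, unitZ]
  congr 1
  ring

/-- `Re Λ₁(T) → λ₁`. -/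
theorem tendsto_re_boxSum_one :
    Tendsto (fun T : ℝ ↦ ((∑ ρ ∈ (liZeroBox_finite T).toFinset,
      (riemannZetaZeroOrder ρ : ℂ) * (1 - (1 - 1 / ρ) ^ 1))).re) atTop (𝓝 (keiperLiCoeff 1)) := by
  have h' : Tendsto (fun T : ℝ ↦ ((∑ ρ ∈ (liZeroBox_finite T).toFinset,
      (riemannZetaZeroOrder ρ : ℂ) * (1 - (1 - 1 / ρ) ^ 1))).re) atTop (𝓝 (keiperLiCoeff 1)) := by
    have := (Complex.continuous_re.tendsto _).comp (tendsto_boxSum (n := 1) le_rfl)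
    simp only [Complex.ofReal_re] at this
    exact this
  exact h'

/-- **Uniform tail bound under RH.** `|d_n − g_T(n)| ≤ 2(λ₁ − Re Λ₁(T))` for every `n ≥ 1` and every `T`
(the zeros outside the box have total coefficient mass `Σ m/|ρ|² = 2(λ₁ − Re Λ₁(T))`). -/
theorem abs_liSecondDiff_sub_ctrigSum_le (hRH : RiemannHypothesis) {n : ℕ} (hn : 1 ≤ n) (T : ℝ) :
    |(keiperLiCoeff (n + 2) - 2 * keiperLiCoeff (n + 1) + keiperLiCoeff n) - ctrigSum (box T) coef unitZ n|
      ≤ 2 * (keiperLiCoeff 1 - ((∑ ρ ∈ (liZeroBox_finite T).toFinset,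
          (riemannZetaZeroOrder ρ : ℂ) * (1 - (1 - 1 / ρ) ^ 1))).re) := by
  classical
  set d : ℝ := keiperLiCoeff (n + 2) - 2 * keiperLiCoeff (n + 1) + keiperLiCoeff n with hd
  have hlim : Tendsto (fun T' : ℝ ↦ ctrigSum (box T') coef unitZ n) atTop (𝓝 d) := by
    have h1 : Tendsto (fun T' : ℝ ↦
        (∑ ρ ∈ (liZeroBox_finite T').toFinset, (riemannZetaZeroOrder ρ : ℂ) * (1 - (1 - 1 / ρ) ^ (n + 2)))
        - 2 * (∑ ρ ∈ (liZeroBox_finite T').toFinset, (riemannZetaZeroOrder ρ : ℂ) * (1 - (1 - 1 / ρ) ^ (n + 1)))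
        + (∑ ρ ∈ (liZeroBox_finite T').toFinset, (riemannZetaZeroOrder ρ : ℂ) * (1 - (1 - 1 / ρ) ^ n)))
        atTop (𝓝 ((keiperLiCoeff (n + 2) : ℂ) - 2 * (keiperLiCoeff (n + 1) : ℂ) + (keiperLiCoeff n : ℂ))) :=
      ((tendsto_boxSum (n := n + 2) (by omega)).sub
        ((tendsto_boxSum (n := n + 1) (by omega)).const_mul 2)).add (tendsto_boxSum hn)
    have h2 := (Complex.continuous_re.tendsto _).comp h1
    have e : ((keiperLiCoeff (n + 2) : ℂ) - 2 * (keiperLiCoeff (n + 1) : ℂ) + (keiperLiCoeff n : ℂ)).re = d := by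
      simp [hd]
    rw [e] at h2
    refine h2.congr fun T' ↦ ?_
    rw [Function.comp_apply, ← ctrigSum_box_eq]
  have hev : ∀ᶠ T' in atTop, |ctrigSum (box T') coef unitZ n - ctrigSum (box T) coef unitZ n|
      ≤ 2 * (keiperLiCoeff 1 - ((∑ ρ ∈ (liZeroBox_finite T).toFinset,
          (riemannZetaZeroOrder ρ : ℂ) * (1 - (1 - 1 / ρ) ^ 1))).re) := by
    filter_upwards [eventually_ge_atTop T] with T' hT'
    have hsub : box T ⊆ box T' := box_mono hT'
    have hdiff : ctrigSum (box T') coef unitZ n - ctrigSum (box T) coef unitZ n =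
        ∑ ρ ∈ box T' \ box T, (coef ρ * unitZ ρ ^ n).re := by
      rw [ctrigSum, ctrigSum, ← Finset.sum_sdiff hsub, add_sub_cancel_right]
    have hmass : ∑ ρ ∈ box T' \ box T, ‖coef ρ‖ = cmass (box T') coef - cmass (box T) coef := by
      rw [cmass, cmass, ← Finset.sum_sdiff hsub, add_sub_cancel_right]
    rw [hdiff]
    calc |∑ ρ ∈ box T' \ box T, (coef ρ * unitZ ρ ^ n).re|
        ≤ ∑ ρ ∈ box T' \ box T, ‖coef ρ‖ := by
          refine (Finset.abs_sum_le_sum_abs _ _).trans (Finset.sum_le_sum fun ρ hρ ↦ ?_)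
          have hρ' : ρ ∈ box T' := (Finset.mem_sdiff.1 hρ).1
          refine (abs_re_le_norm _).trans ?_
          rw [norm_mul, norm_pow, (box_rh hRH hρ').2.1, one_pow, mul_one]
      _ = cmass (box T') coef - cmass (box T) coef := hmass
      _ ≤ _ := by
          rw [cmass_box hRH T', cmass_box hRH T]
          linarith [re_boxSum_one_le T']
  have hT := (hlim.sub_const (ctrigSum (box T) coef unitZ n)).abs
  exact le_of_tendsto hT hev

/-- Under RH some box is non-empty (else every box sum vanishes and `λ_n = 0`, contradicting
`eventually_pos_of_rh`). -/
theorem exists_box_nonempty (hRH : RiemannHypothesis) : ∃ T : ℝ, (box T).Nonempty := by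
  by_contra h
  push Not at h
  obtain ⟨n₀, hn₀⟩ := eventually_pos_of_rh hRH
  have hpos := hn₀ (max n₀ 1) (le_max_left _ _)
  have hlim := tendsto_boxSum (n := max n₀ 1) (le_max_right _ _)
  have hzero : (fun T : ℝ ↦ ∑ ρ ∈ (liZeroBox_finite T).toFinset,
      (riemannZetaZeroOrder ρ : ℂ) * (1 - (1 - 1 / ρ) ^ (max n₀ 1))) = fun _ ↦ 0 := by
    funext T
    have hT : box T = ∅ := h T
    rw [box] at hT
    rw [hT, Finset.sum_empty]
  rw [hzero] at hlim
  have h0 := tendsto_nhds_unique tendsto_const_nhds hlim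
  have : keiperLiCoeff (max n₀ 1) = 0 := by exact_mod_cast h0.symm
  linarith

/-- **RH branch.** Under RH there are `η > 0` and `L` such that every window `[N, N+L)`, `N ≥ 1`, contains an
`n` with `d_n ≥ η` and an `n'` with `d_{n'} ≤ −η`. -/
theorem liSecondDiff_two_signs_of_rh (hRH : RiemannHypothesis) :
    ∃ η : ℝ, 0 < η ∧ ∃ L : ℕ, ∀ N : ℕ, 1 ≤ N →
      (∃ n ∈ Ico N (N + L), η ≤ keiperLiCoeff (n + 2) - 2 * keiperLiCoeff (n + 1) + keiperLiCoeff n) ∧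
      (∃ n ∈ Ico N (N + L), keiperLiCoeff (n + 2) - 2 * keiperLiCoeff (n + 1) + keiperLiCoeff n ≤ -η) := by
  obtain ⟨T₀, hT₀⟩ := exists_box_nonempty hRH
  have hσ₀ : 0 < csqMass (box T₀) coef := csqMass_box_pos hT₀
  have hM₀ : 0 < cmass (box T₀) coef := cmass_pos hσ₀
  have hl : 0 < keiperLiCoeff 1 := by linarith [cmass_box_le hRH T₀]
  have hl0 : keiperLiCoeff 1 ≠ 0 := hl.ne'
  set η : ℝ := csqMass (box T₀) coef / (32 * keiperLiCoeff 1) with hηdef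
  have hη : 0 < η := by positivity
  obtain ⟨T₁, hT₁⟩ := Metric.tendsto_atTop.1 tendsto_re_boxSum_one (η / 2) (by positivity)
  set T := max T₀ T₁ with hTdef
  have htail : 2 * (keiperLiCoeff 1 - ((∑ ρ ∈ (liZeroBox_finite T).toFinset,
      (riemannZetaZeroOrder ρ : ℂ) * (1 - (1 - 1 / ρ) ^ 1))).re) ≤ η := by
    have h := hT₁ T (le_max_right _ _)
    rw [Real.dist_eq] at h
    have := (abs_lt.1 h).1
    linarith
  have hsub : box T₀ ⊆ box T := box_mono (le_max_left _ _)
  have hσ : 0 < csqMass (box T) coef := csqMass_box_pos (hT₀.mono hsub)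
  have hMT : 0 < cmass (box T) coef := cmass_pos hσ
  have hwin := cwindow_two_signs (box_hu hRH T) (box_hu1 T) (box_hres hRH T) (box_hres' T) hσ
  have hmargin : 2 * η ≤ cmargin (box T) coef := by
    have h1 : csqMass (box T₀) coef ≤ csqMass (box T) coef := csqMass_mono (le_max_left _ _)
    have h2 : cmass (box T) coef ≤ 2 * keiperLiCoeff 1 := cmass_box_le hRH T
    rw [cmargin, hηdef, le_div_iff₀ (by positivity)]
    calc 2 * (csqMass (box T₀) coef / (32 * keiperLiCoeff 1)) * (8 * cmass (box T) coef)
        = csqMass (box T₀) coef * (cmass (box T) coef / (2 * keiperLiCoeff 1)) := by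
          field_simp
          ring
      _ ≤ csqMass (box T) coef * 1 := by
          refine mul_le_mul h1 ?_ (by positivity) hσ.le
          rw [div_le_one (by positivity)]
          exact h2
      _ = csqMass (box T) coef := mul_one _
  refine ⟨η, hη, cwindowLen (box T) coef unitZ, fun N hN ↦ ⟨?_, ?_⟩⟩
  · obtain ⟨n, hn, hge⟩ := (hwin N).1
    refine ⟨n, hn, ?_⟩
    have hn1 : 1 ≤ n := hN.trans (Finset.mem_Ico.1 hn).1
    have h := abs_le.1 (abs_liSecondDiff_sub_ctrigSum_le hRH hn1 T)
    linarith [h.1, h.2]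
  · obtain ⟨n, hn, hle⟩ := (hwin N).2
    refine ⟨n, hn, ?_⟩
    have hn1 : 1 ≤ n := hN.trans (Finset.mem_Ico.1 hn).1
    have h := abs_le.1 (abs_liSecondDiff_sub_ctrigSum_le hRH hn1 T)
    linarith [h.1, h.2]

end RHBranch

end Summit.RiemannHypothesis.RiemannHypothesis.Theorems.Splittings.LiCurvatureSignChanges

end
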